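import Mathlib
import HarnessLib
import HarnessLib.Audit.Tags

/-!
# HodgeLocusCensusRamified7BCore — ENGINE B (pub-hlocus abs-2, gen 32): finite core of the engine-B COUNTERSIGN of ROW 7 / THEOREM R7
(V3-XT N = 1, `ℓ = 7` ramified in `K = ℚ(√-7m)`, `j ≡ -3375`: the census of `v'(j(C) + 3375)` on `Cl(-7m)`, `Cl(-28m)`).

HONEST FRAMING: certified instances and evidence bearing on the general Hodge conjecture; no claim.

Informal companion: `run/shared/lean/pub/pub-hlocus/code/abs_engineB/v3B/xt/n1ram7/DERIVATION-R7-B.md` (engine-B countersign of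
engine A's `DERIVATION-R7-A.md`; engine A's finite core is `HodgeLocusCensusRamified7`).  Engine B splits the maximal order
`O = ℤ⟨1, i, (1+j)/2, (i+k)/2⟩` of `B = (-1,-7)_ℚ` as `O = O_{k₀} ⊕ O_{k₀}·i` (`k₀ = ℚ(√-7) = ℚ(j)`), so that
`nrd(α + βi) = N(α) + N(β)`; an optimal embedding of `O_D` (`D = -7m, -28m`, `7 ∤ m`) is `√D ↦ y = 7b'i + cj + dk = cj + x·i`,
`x = 7b' - dj`, `N(x) = 7(7b'² + d²)`; the Gross level of `y` is `ℓ = v₇(N(x))` by a NORM-RESIDUE LEMMA (`-1` is not a norm residue: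
`N(u₀ + u₁√-7) ≡ u₀² (mod 7)` and `-1` is a non-square mod `7`), the length is `ℓ + 1` [cite: KudlaRapoportYang2006, (3.6.11)–(3.6.12)],
and the projection formula on the double cover `X → X/⟨i⟩` (deformation space → formal `j`-line) turns it into
`v'(j(C) + 3375) = 2 + v₇(7b'² + d²)`.  The number of admissible `y` is `2h(D)` by Eichler's optimal-embedding theorem
[cite: Ogg1983, Thm 1–2] (`ν₇ = 1 - (D/7) = 1`, `|O^×| = 4`, stabiliser `±1`), and the descent `α ∈ 𝔭ᵗ ⟺ 7ᵗ ∣ N(α)` along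
`𝔭 = (√-7)` gives the dictionary `2ν'_t(-7m) = r(m; c² + 4·7ᵗΘ₇)`, `2ν'_t(-28m) = r(m; c² + 7ᵗΘ₇) - [m ≡ 1 (4)] r(m; c² + 4·7ᵗΘ₇)`.

Kernel-checked here (no `sorry`, no new axioms; `decide` / `norm_num` / `ring` / `omega` / `nlinarith` / `field_simp`):
* `qmul`, `nrd`, `structure_constants`, `assoc_basis`, `nrd_mul` — the product of `(-1,-7)_ℚ` on integer coordinates (`i² = -1`, `j² = -7`,
  `ij = k = -ji`, `k² = -7`, `jk = 7i`, `ki = j`, `ik = -j`), associativity on the basis, multiplicativity of `nrd(a,b,c,d) = a² + b² + 7c² + 7d²`;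
* `split_coords`, `nrd_split`, `sq_trace_zero` — (1.1) of the companion: `(a₀ + a₁j) + (b₀ + b₁j)·i = a₀ + b₀i + a₁j - b₁k`,
  `nrd = N(a₀ + a₁j) + N(b₀ + b₁j)`; `y² = -nrd(y)` for trace-zero `y`;
* `embed_coords`, `conj_by_i` — `cj + (7b' - dj)·i = 7b'i + cj + dk` with `N(7b' - dj) = 7(7b'² + d²)`, and `i y i⁻¹ = 7b'i - cj - dk`
  (the `⟨i⟩`-orbit `{(b',c,d), (b',-c,-d)}`);
* `norm_mod_seven`, `norm_residue_lemma`, `neg_one_nonsquare_mod_seven` — `N(u₀ + u₁√-7) ≡ u₀²` and `u₀² + w₀² ≢ 0 (mod 7)` for `w₀ ≢ 0`: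
  the Gross level of `cj + x·i` cannot exceed `v₇(N(x))`;
* `level_eq`, `vprime_eq` — `v₇(49b'² + 7d²) = 1 + v₇(7b'² + d²)`, so `v' = level + 1 = 2 + v₇(7b'² + d²)`;
* `theta7`, `theta_mod_seven`, `descent_norm` — `7 ∣ Θ₇(x,y) ⟺ 7 ∣ 2x + y` (`α ∈ 𝔭 ⟺ 7 ∣ N(α)`), and then `Θ₇(x,y) = 7·Θ₇(4z - x, -z)`
  (`2x + y = 7z`; `α/√-7 = (4z - x) - zω`): engine B's `𝔭`-descent inside `O_{k₀}` (engine A descends in `ℤ[√-7]`);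
* `pair_param`, `pair_param_inv` — `(x, y) ↦ (b', d) = (y, 2x + y)`: `7b'² + d² = 4Θ₇(x,y)`, `b' ≡ d (mod 2)`, and back;
* `eichler_anchor_29`, `eichler_anchor_2`, `eichler_anchor_11` — counts of admissible vectors by `decide` over complete boxes, each with its
  level count: `#{7b'² + c² + d² = 29, b' ≡ d (2)} = 8 = 2h(-203)`, `4 = 2ν` of them with `7 ∣ d`; `#{… = 8, c even, b' ≡ d (2)} = 8 = 2h(-56)`, `0` at level `≥ 1`;
  `#{… = 44, c even, b' ≡ d (2)} = 16 = 2h(-308)`, `4 = 2ν` at level `≥ 1` (so `a₂₉ = 2`, `b₂ = -1`, `b₁₁ = 0`, [cite: Lehman1987, Table I]);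
  `dictionary_anchors` — the same numbers through (D7): `r(29; c² + 4Θ₇) = 8`, `r(29; c² + 28Θ₇) = 4`, `r(2; c² + Θ₇) = 8`, `r(2; c² + 7Θ₇) = 0`,
  `r(11; c² + Θ₇) = 16`, `r(11; c² + 7Θ₇) = 4`; `theta_box` — completeness of the boxes (`7x² ≤ 8Θ₇`, `7y² ≤ 4Θ₇`);
* `eighth_law_shapes`, `eighth_law_zero_iff` — `(h - 4ν)²/8 = a²/2` (`a = 2ν - h/2`) `= 2b²` (`b = ν - h/4`) (EIGHTH LAW ↔ [cite: Lehman1987, Thm 2]),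
  and `(h - 4ν)²/8 = 0 ⟺ 4ν = h`;
* `closed_form_exponents` — the `lindep` certificates `[2,-2,2,1,2]`, `[1,-1,1,0,2]` of the companion §5.4 as exponent relations
  (`Ω₀²·π²·7·2² = G²`, `Ω₀⁻·π·2² = G`, `G = Γ(1/7)Γ(2/7)Γ(4/7)`) imply `(Ω₀⁻/Ω₀)² = 7/4`.
The cited inputs (Gross/KRY length, Eichler's theorem, deformation theory at `j = 1728`), the census itself and the theta identities are NOT re-proved here.
-/

set_option maxRecDepth 32768


namespace Summit.HodgeConjecture.HodgeConjecture.HodgeLocus.Census.Ramified7BCore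

/-! ### The algebra `(-1,-7)_ℚ` on integer coordinates `(a, b, c, d) ↔ a + b i + c j + d k` -/

/-- Product in `(-1,-7)`: `i² = -1`, `j² = -7`, `k = ij = -ji`, `k² = -7`, `ik = -j`, `ki = j`, `jk = 7i`… derived from the rules. -/
def qmul (x y : ℤ × ℤ × ℤ × ℤ) : ℤ × ℤ × ℤ × ℤ :=
  let (a, b, c, d) := x
  let (e, f, g, h) := y
  (a * e - b * f - 7 * c * g - 7 * d * h,
   a * f + b * e + 7 * c * h - 7 * d * g,
   a * g + c * e - b * h + d * f,
   a * h + d * e + b * g - c * f)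

/-- Reduced norm `a² + b² + 7c² + 7d²`. -/
def nrd (x : ℤ × ℤ × ℤ × ℤ) : ℤ := x.1 ^ 2 + x.2.1 ^ 2 + 7 * x.2.2.1 ^ 2 + 7 * x.2.2.2 ^ 2

/-- The basis element `i`. -/
def qi : ℤ × ℤ × ℤ × ℤ := (0, 1, 0, 0)
/-- The basis element `j` (`j² = -7`). -/
def qj : ℤ × ℤ × ℤ × ℤ := (0, 0, 1, 0)
/-- The basis element `k = ij`. -/
def qk : ℤ × ℤ × ℤ × ℤ := (0, 0, 0, 1)

/-- Structure constants: `i² = -1`, `j² = -7`, `k² = -7`, `ij = k`, `ji = -k`, `jk = 7i`, `ki = j`, `ik = -j`. -/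
theorem structure_constants :
    qmul qi qi = (-1, 0, 0, 0) ∧ qmul qj qj = (-7, 0, 0, 0) ∧ qmul qk qk = (-7, 0, 0, 0) ∧
    qmul qi qj = qk ∧ qmul qj qi = (0, 0, 0, -1) ∧ qmul qj qk = (0, 7, 0, 0) ∧ qmul qk qi = qj ∧ qmul qi qk = (0, 0, -1, 0) := by
  decide

/-- Associativity on the basis (a finite sanity check of the product table). -/
theorem assoc_basis : ∀ x ∈ [qi, qj, qk], ∀ y ∈ [qi, qj, qk], ∀ z ∈ [qi, qj, qk], qmul (qmul x y) z = qmul x (qmul y z) := by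
  decide

/-- The reduced norm is multiplicative (so `qmul` is the quaternion product with norm form `⟨1, 1, 7, 7⟩`). -/
theorem nrd_mul (x y : ℤ × ℤ × ℤ × ℤ) : nrd (qmul x y) = nrd x * nrd y := by
  obtain ⟨a, b, c, d⟩ := x; obtain ⟨e, f, g, h⟩ := y
  simp only [qmul, nrd]; ring

/-! ### (1.1): `O = O_{k₀} ⊕ O_{k₀}·i`, `nrd(α + βi) = N(α) + N(β)` -/

/-- `(a₀ + a₁ j) + (b₀ + b₁ j)·i = a₀ + b₀ i + a₁ j - b₁ k`. -/
theorem split_coords (a₀ a₁ b₀ b₁ : ℤ) :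
    (a₀, 0, a₁, 0) + qmul (b₀, 0, b₁, 0) qi = (a₀, b₀, a₁, -b₁) := by
  simp only [qmul, qi, Prod.mk_add_mk]; ring_nf

/-- `nrd(a₀ + b₀ i + a₁ j - b₁ k) = (a₀² + 7a₁²) + (b₀² + 7b₁²) = N(α) + N(β)`. -/
theorem nrd_split (a₀ a₁ b₀ b₁ : ℤ) :
    nrd (a₀, b₀, a₁, -b₁) = (a₀ ^ 2 + 7 * a₁ ^ 2) + (b₀ ^ 2 + 7 * b₁ ^ 2) := by
  simp only [nrd]; ring

/-- The embedding vector: `c j + (7b' - d j)·i = 7b' i + c j + d k`, of reduced norm `7(7b'² + c² + d²)`, with `N(7b' - dj) = 7(7b'² + d²)`. -/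
theorem embed_coords (b' c d : ℤ) :
    (0, 0, c, 0) + qmul (7 * b', 0, -d, 0) qi = (0, 7 * b', c, d) ∧
    nrd (0, 7 * b', c, d) = 7 * (7 * b' ^ 2 + c ^ 2 + d ^ 2) ∧
    (7 * b') ^ 2 + 7 * (-d) ^ 2 = 7 * (7 * b' ^ 2 + d ^ 2) := by
  refine ⟨?_, ?_, ?_⟩
  · simp only [qmul, qi, Prod.mk_add_mk]; ring_nf
  · simp only [nrd]; ring
  · ring

/-- Conjugation by the unit `i` (`i⁻¹ = -i`): `i (7b'i + cj + dk) i⁻¹ = 7b'i - cj - dk` — the `⟨i⟩`-orbit is `{(b', c, d), (b', -c, -d)}`. -/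
theorem conj_by_i (b c d : ℤ) : qmul (qmul qi (0, b, c, d)) (0, -1, 0, 0) = (0, b, -c, -d) := by
  simp only [qmul, qi]; ring_nf

/-- `y² = -nrd(y)` for trace-zero `y`: the vector represents `√D` with `D = -7(7b'² + c² + d²)`. -/
theorem sq_trace_zero (b c d : ℤ) : qmul (0, b, c, d) (0, b, c, d) = (-(b ^ 2 + 7 * c ^ 2 + 7 * d ^ 2), 0, 0, 0) := by
  simp only [qmul]; ring_nf

/-! ### The norm-residue lemma (Gross level `= v₇(N(x))`) -/

/-- `N(u₀ + u₁√-7) = u₀² + 7u₁² ≡ u₀² (mod 7)`. -/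
theorem norm_mod_seven (u₀ u₁ : ℤ) : (u₀ ^ 2 + 7 * u₁ ^ 2 : ZMod 7) = (u₀ : ZMod 7) ^ 2 := by
  have : (7 : ZMod 7) = 0 := by decide
  simp [this]

/-- `-1` is not a norm residue: `u₀² + w₀² ≢ 0 (mod 7)` unless `w₀ ≡ 0` (and then `u₀ ≡ 0`).  Hence for norms `N₁ = N(cj - a)`,
`N₂ = N(x)` of EQUAL `7`-adic valuation the sum has the same valuation: no `a ∈ O_k` improves on `a = cj`, so the level of
`cj + x·i` is exactly `v₇(N(x))`. -/
theorem norm_residue_lemma : ∀ u₀ w₀ : ZMod 7, w₀ ≠ 0 → u₀ ^ 2 + w₀ ^ 2 ≠ 0 := by decide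

/-- The squares mod `7` are `{0, 1, 2, 4}`; `-1 = 6` is not among them. -/
theorem neg_one_nonsquare_mod_seven : ∀ u : ZMod 7, u ^ 2 ≠ -1 := by decide

/-- `v₇(N(x)) = v₇(49b'² + 7d²) = 1 + v₇(7b'² + d²)` (for a nonzero argument). -/
theorem level_eq (b' d : ℕ) (h : 7 * b' ^ 2 + d ^ 2 ≠ 0) :
    padicValNat 7 (49 * b' ^ 2 + 7 * d ^ 2) = 1 + padicValNat 7 (7 * b' ^ 2 + d ^ 2) := by
  haveI : Fact (Nat.Prime 7) := ⟨by norm_num⟩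
  have h7 : (49 * b' ^ 2 + 7 * d ^ 2) = 7 * (7 * b' ^ 2 + d ^ 2) := by ring
  rw [h7, padicValNat.mul (by norm_num) h, padicValNat.self (by norm_num)]

/-- The valuation law of the companion, (V7): `v' = (level) + 1 = 2 + v₇(7b'² + d²)`. -/
theorem vprime_eq (b' d : ℕ) (h : 7 * b' ^ 2 + d ^ 2 ≠ 0) :
    padicValNat 7 (49 * b' ^ 2 + 7 * d ^ 2) + 1 = 2 + padicValNat 7 (7 * b' ^ 2 + d ^ 2) := by
  rw [level_eq b' d h]; ring

/-! ### The `𝔭`-descent in `O_{k₀} = ℤ[(1+√-7)/2]` (norm form `Θ₇(x,y) = x² + xy + 2y²`) -/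

/-- `Θ₇`. -/
def theta7 (x y : ℤ) : ℤ := x ^ 2 + x * y + 2 * y ^ 2

/-- `7 ∣ Θ₇(x, y) ⟺ 7 ∣ 2x + y` (`α ∈ 𝔭 ⟺ 7 ∣ N(α)`, `𝔭 = (√-7)` the ramified prime). -/
theorem theta_mod_seven : ∀ x y : ZMod 7, x ^ 2 + x * y + 2 * y ^ 2 = 0 ↔ 2 * x + y = 0 := by decide

/-- Division by `√-7`: if `2x + y = 7z` then `α/√-7 = (4z - x) - z·ω` (`ω = (1+√-7)/2`) lies in `O_{k₀}` and `N(α) = 7·N(α/√-7)`. -/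
theorem descent_norm (x y z : ℤ) (h : 2 * x + y = 7 * z) : theta7 x y = 7 * theta7 (4 * z - x) (-z) := by
  have hy : y = 7 * z - 2 * x := by omega
  subst hy; simp only [theta7]; ring

/-- (3.1) of the companion: `(x, y) ↦ (b', d) = (y, 2x + y)` has `7b'² + d² = 4Θ₇(x, y)` and `b' ≡ d (mod 2)`;
conversely `x = (d - b')/2`. -/
theorem pair_param (x y : ℤ) : 7 * y ^ 2 + (2 * x + y) ^ 2 = 4 * theta7 x y ∧ (2 : ℤ) ∣ (2 * x + y) - y := by
  refine ⟨by simp only [theta7]; ring, ⟨x, by ring⟩⟩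

/-- Inverse direction of `pair_param`: a same-parity pair `(b', d)` is `(y, 2x + y)` with `x = (d - b')/2`. -/
theorem pair_param_inv (b' d x : ℤ) (h : d - b' = 2 * x) : 7 * b' ^ 2 + d ^ 2 = 4 * theta7 x b' := by
  have hd : d = 2 * x + b' := by omega
  subst hd; simp only [theta7]; ring

/-! ### Eichler-count and level anchors (complete boxes, `decide`) -/

/-- Admissible vectors for `D = -7·29` (`M = 29`, `c` odd automatic, `b' ≡ d (2)`): the box `|b'| ≤ 2`, `|c|, |d| ≤ 5` is complete
(`7b'² ≤ 29`, `c², d² ≤ 29`).  Count `8 = 2·h(-203)` (`h = 4`), of which `4` have `7 ∣ d` (level `≥ 1`): `2ν = 4`, `ν = 2`,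
`a₂₉ = 2ν - h/2 = 2` [cite: Lehman1987, Table I]. -/
theorem eichler_anchor_29 :
    (((Finset.Icc (-2 : ℤ) 2) ×ˢ (Finset.Icc (-5 : ℤ) 5) ×ˢ (Finset.Icc (-5 : ℤ) 5)).filter
      (fun v => 7 * v.1 ^ 2 + v.2.1 ^ 2 + v.2.2 ^ 2 = 29 ∧ (v.1 - v.2.2) % 2 = 0)).card = 8 ∧
    (((Finset.Icc (-2 : ℤ) 2) ×ˢ (Finset.Icc (-5 : ℤ) 5) ×ˢ (Finset.Icc (-5 : ℤ) 5)).filter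
      (fun v => 7 * v.1 ^ 2 + v.2.1 ^ 2 + v.2.2 ^ 2 = 29 ∧ (v.1 - v.2.2) % 2 = 0 ∧ v.2.2 % 7 = 0)).card = 4 := by
  constructor <;> decide

/-- `D = -56` (`m = 2`, `M = 8`, `c` even, `b' ≡ d (2)`; no imprimitive vectors since `-14` is not a discriminant): box `|b'| ≤ 1`,
`|c|, |d| ≤ 2`; count `8 = 2·h(-56)` (`h = 4`), none with `7 ∣ d` and `d, b'` not both… level `≥ 1` needs `7 ∣ 7b'² + d²`: `0` vectors,
so `ν = 0`, `b₂ = ν - h/4 = -1` [cite: Lehman1987, Table I]. -/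
theorem eichler_anchor_2 :
    (((Finset.Icc (-1 : ℤ) 1) ×ˢ (Finset.Icc (-2 : ℤ) 2) ×ˢ (Finset.Icc (-2 : ℤ) 2)).filter
      (fun v => 7 * v.1 ^ 2 + v.2.1 ^ 2 + v.2.2 ^ 2 = 8 ∧ v.2.1 % 2 = 0 ∧ (v.1 - v.2.2) % 2 = 0)).card = 8 ∧
    (((Finset.Icc (-1 : ℤ) 1) ×ˢ (Finset.Icc (-2 : ℤ) 2) ×ˢ (Finset.Icc (-2 : ℤ) 2)).filter
      (fun v => 7 * v.1 ^ 2 + v.2.1 ^ 2 + v.2.2 ^ 2 = 8 ∧ v.2.1 % 2 = 0 ∧ (v.1 - v.2.2) % 2 = 0 ∧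
        (7 * v.1 ^ 2 + v.2.2 ^ 2) % 7 = 0 ∧ 7 * v.1 ^ 2 + v.2.2 ^ 2 ≠ 0)).card = 0 := by
  constructor <;> decide

/-- `D = -308` (`m = 11`, `M = 44`, `c` even, `b' ≡ d (2)`, `m ≡ 3 (4)` so no imprimitive vectors): box `|b'| ≤ 2`, `|c|, |d| ≤ 6`;
count `16 = 2·h(-308)` (`h = 8`), of which `4` at level `≥ 1` (`7 ∣ 7b'² + d² ≠ 0`): `ν = 2 = h/4`, `b₁₁ = 0`, `L(E^{(11)}, 1) = 0`
[cite: Lehman1987, Table I]. -/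
theorem eichler_anchor_11 :
    (((Finset.Icc (-2 : ℤ) 2) ×ˢ (Finset.Icc (-6 : ℤ) 6) ×ˢ (Finset.Icc (-6 : ℤ) 6)).filter
      (fun v => 7 * v.1 ^ 2 + v.2.1 ^ 2 + v.2.2 ^ 2 = 44 ∧ v.2.1 % 2 = 0 ∧ (v.1 - v.2.2) % 2 = 0)).card = 16 ∧
    (((Finset.Icc (-2 : ℤ) 2) ×ˢ (Finset.Icc (-6 : ℤ) 6) ×ˢ (Finset.Icc (-6 : ℤ) 6)).filter
      (fun v => 7 * v.1 ^ 2 + v.2.1 ^ 2 + v.2.2 ^ 2 = 44 ∧ v.2.1 % 2 = 0 ∧ (v.1 - v.2.2) % 2 = 0 ∧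
        (7 * v.1 ^ 2 + v.2.2 ^ 2) % 7 = 0 ∧ 7 * v.1 ^ 2 + v.2.2 ^ 2 ≠ 0)).card = 4 := by
  constructor <;> decide

/-- The same three anchors through the dictionary (D7): `r(29; c² + 4Θ₇) = 8`, `r(29; c² + 28Θ₇) = 4`; `r(2; c² + Θ₇) = 8`,
`r(2; c² + 7Θ₇) = 0`; `r(11; c² + Θ₇) = 16`, `r(11; c² + 7Θ₇) = 4` — complete boxes (`Θ₇(x,y) ≥ (7/8)·max(x²,y²)/…`; we take
generous boxes `|x|, |y|, |c| ≤ 6`). -/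
theorem dictionary_anchors :
    (((Finset.Icc (-6 : ℤ) 6) ×ˢ (Finset.Icc (-6 : ℤ) 6) ×ˢ (Finset.Icc (-6 : ℤ) 6)).filter
      (fun v => v.1 ^ 2 + 4 * (v.2.1 ^ 2 + v.2.1 * v.2.2 + 2 * v.2.2 ^ 2) = 29)).card = 8 ∧
    (((Finset.Icc (-6 : ℤ) 6) ×ˢ (Finset.Icc (-6 : ℤ) 6) ×ˢ (Finset.Icc (-6 : ℤ) 6)).filter
      (fun v => v.1 ^ 2 + 28 * (v.2.1 ^ 2 + v.2.1 * v.2.2 + 2 * v.2.2 ^ 2) = 29)).card = 4 ∧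
    (((Finset.Icc (-6 : ℤ) 6) ×ˢ (Finset.Icc (-6 : ℤ) 6) ×ˢ (Finset.Icc (-6 : ℤ) 6)).filter
      (fun v => v.1 ^ 2 + (v.2.1 ^ 2 + v.2.1 * v.2.2 + 2 * v.2.2 ^ 2) = 2)).card = 8 ∧
    (((Finset.Icc (-6 : ℤ) 6) ×ˢ (Finset.Icc (-6 : ℤ) 6) ×ˢ (Finset.Icc (-6 : ℤ) 6)).filter
      (fun v => v.1 ^ 2 + 7 * (v.2.1 ^ 2 + v.2.1 * v.2.2 + 2 * v.2.2 ^ 2) = 2)).card = 0 ∧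
    (((Finset.Icc (-6 : ℤ) 6) ×ˢ (Finset.Icc (-6 : ℤ) 6) ×ˢ (Finset.Icc (-6 : ℤ) 6)).filter
      (fun v => v.1 ^ 2 + (v.2.1 ^ 2 + v.2.1 * v.2.2 + 2 * v.2.2 ^ 2) = 11)).card = 16 ∧
    (((Finset.Icc (-6 : ℤ) 6) ×ˢ (Finset.Icc (-6 : ℤ) 6) ×ˢ (Finset.Icc (-6 : ℤ) 6)).filter
      (fun v => v.1 ^ 2 + 7 * (v.2.1 ^ 2 + v.2.1 * v.2.2 + 2 * v.2.2 ^ 2) = 11)).card = 4 := by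
  refine ⟨?_, ?_, ?_, ?_, ?_, ?_⟩ <;> decide

/-- Completeness of the boxes used above: `Θ₇(x, y) ≥ 7y²/8`-type bounds in integer form, `8Θ₇ ≥ 7x²` and `4Θ₇ ≥ 7y²`. -/
theorem theta_box (x y : ℤ) : 7 * x ^ 2 ≤ 8 * theta7 x y ∧ 7 * y ^ 2 ≤ 4 * theta7 x y := by
  constructor
  · simp only [theta7]; nlinarith [sq_nonneg (x + 4 * y), sq_nonneg y]
  · simp only [theta7]; nlinarith [sq_nonneg (2 * x + y)]

/-! ### THEOREM R7 / EIGHTH LAW shapes and the closed-form bookkeeping -/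

/-- EIGHTH LAW `A₁ = (h - 4ν)²/8` versus [cite: Lehman1987, Thm 2]: with `a = 2ν - h/2`, `(h - 4ν)²/8 = a²/2`; with `b = ν - h/4`,
`(h - 4ν)²/8 = 2b²`.  So `L(E^{(m)},1) = ω₁·a_m²/2` (`m ≡ 1 (4)`) and `= ω₁·2b_m²` (`m ≡ 2,3 (4)`), `ω₁ = Ω₀/√f_m`. -/
theorem eighth_law_shapes (h ν : ℚ) :
    (h - 4 * ν) ^ 2 / 8 = (2 * ν - h / 2) ^ 2 / 2 ∧ (h - 4 * ν) ^ 2 / 8 = 2 * (ν - h / 4) ^ 2 := by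
  constructor <;> ring

/-- `L = 0 ⟺ 4ν = h` at the level of the rational factor. -/
theorem eighth_law_zero_iff (h ν : ℚ) : (h - 4 * ν) ^ 2 / 8 = 0 ↔ 4 * ν = h := by
  constructor
  · intro h0
    have : (h - 4 * ν) ^ 2 = 0 := by linarith
    have := pow_eq_zero_iff (n := 2) (by norm_num) |>.mp this
    linarith
  · intro h1; rw [← h1]; ring

/-- The `lindep` certificates of the companion §5.4 as exponent relations: `[2, -2, 2, 1, 2]` says `Ω₀² · π² · 7 · 2² = G²`, i.e.
`Ω₀ = G/(2π√7)`; `[1, -1, 1, 0, 2]` says `Ω₀⁻ · π · 2² = G`, i.e. `Ω₀⁻ = G/(4π)`; consequently `Ω₀⁻/Ω₀ = √7/2`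
(`(Ω₀⁻/Ω₀)² = 7/4`).  Pure bookkeeping over positive reals. -/
theorem closed_form_exponents (Ω Ωm G π7 : ℝ) (hG : 0 < G) (hπ : 0 < π7)
    (h1 : Ω ^ 2 * π7 ^ 2 * 7 * 2 ^ 2 = G ^ 2) (h2 : Ωm * π7 * 2 ^ 2 = G) :
    (Ωm / Ω) ^ 2 = 7 / 4 := by
  have hΩm : Ωm = G / (4 * π7) := by
    field_simp
    linarith
  have hΩ2 : Ω ^ 2 = G ^ 2 / (28 * π7 ^ 2) := by
    field_simp
    linarith
  rw [div_pow, hΩm, hΩ2, div_pow]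
  field_simp
  ring

end Summit.HodgeConjecture.HodgeConjecture.HodgeLocus.Census.Ramified7BCore
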